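import Summits.KontsevichZagierPeriods.KontsevichZagierPeriods.Theses.InverseLandau
import Summits.KontsevichZagierPeriods.KontsevichZagierPeriods.Theorems.KernelFormKernelImpliesStatement

/-!
# KontsevichZagierPeriods / InverseLandau — the assembly `Assembly` (stmt-KontsevichZagierPeriods-9137)

Route `KontsevichZagierPeriods/InverseLandau` (inverse Landau rigidity — identically vanishing
Tate-degenerate family periods are exact plus defect-lattice loop relators), item
stmt-KontsevichZagierPeriods-9137 (`Assembly`, rank 1), the deciding implication

  `TateFamilyKernel → TateLifting → KontsevichZagierPeriods`.

Pure bookkeeping in the free abelian group `KZ.FormalRep` of integral representations: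

* `TateFamilyKernel` (crux, stmt-KontsevichZagierPeriods-9130) says that every FIBRE
  `[(0,1)ⁿ, P/Q(·,ϖ₀)]` of an admissible Tate family with identically vanishing fibre integrals, at a
  real-algebraic parameter `ϖ₀ ∈ (0,ε)`, is a KZ relation; these fibres are exactly the generators
  of the subgroup `closure {fibres}` appearing in `TateLifting`, so `closure {fibres} ≤ KZ.relations`
  (`AddSubgroup.closure_le`) and `KZ.relations ⊔ closure {fibres} ≤ KZ.relations` (`sup_le`).
* `TateLifting` (target, stmt-KontsevichZagierPeriods-9129) says `ker KZ.eval ≤ KZ.relations ⊔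
  closure {fibres}`; with the previous point this is the kernel form
  `Literature.NumberTheory.Transcendental.KZKernelConjecture`
  (`kzKernelConjecture_of_kernel_of_lifting`).
* The kernel form implies the summit (`r.value = r'.value ⇒ eval ([r] − [r']) = 0 ⇒ [r] − [r'] ∈
  relations`): the tree theorem
  `Summit.KontsevichZagierPeriods.KernelForm.kontsevichZagierPeriods_of_kzKernelConjecture`
  (`Theorems/KernelFormKernelImpliesStatement.lean`).

The composite is `Assembly.assembly_proof`, whose type is literally the route decl. It coincides in
content with the route file's kernel-checked deciding theorem `Theses.InverseLandau.closes`, but is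
proved here independently of it (the route file is gate-generated and may be re-issued). Neither
antecedent is discharged: `TateLifting` is declared GPC-strength and `TateFamilyKernel` is the
route's open crux; the theorem is the implication, nothing more. No definitions, no named facts;
unconditional.

References: M. Kontsevich, D. Zagier, *Periods* (2001), §1.2 (Conjecture 1 and its kernel
reformulation); A. Huber, S. Müller-Stach, *Periods and Nori Motives* (2017), §13.1.
-/

namespace Summit.KontsevichZagierPeriods.InverseLandau.Assembly

open Summit.KontsevichZagierPeriods.KontsevichZagierPeriods.Theses.InverseLandau
open Literature.NumberTheory.Transcendental

/-- **Kernel form from the two halves of inverse Landau rigidity**: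
`TateFamilyKernel → TateLifting → KZKernelConjecture` (`ker KZ.eval ≤ KZ.relations`). `TateLifting`
places every `c ∈ ker eval` in `KZ.relations ⊔ closure {fibres}`; `TateFamilyKernel` puts every
generator of the fibre subgroup — a representation `[r]` with `r.domain = (0,1)ⁿ` and integrand
`P/Q(·,ϖ₀)` on it, for an admissible Tate family `P/Q` with identically vanishing fibre integrals
and a real-algebraic `ϖ₀ ∈ (0,ε)` — into `KZ.relations`, hence the whole subgroup
(`AddSubgroup.closure_le`), so `KZ.relations ⊔ closure {fibres} ≤ KZ.relations` (`sup_le`).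
[Kontsevich–Zagier 2001, §1.2; Huber–Müller-Stach 2017, §13.1] [folklore] -/
theorem kzKernelConjecture_of_kernel_of_lifting (hK : TateFamilyKernel) (hL : TateLifting) :
    KZKernelConjecture := by
  intro c hc
  refine sup_le le_rfl ((AddSubgroup.closure_le _).mpr ?_) (hL c hc)
  rintro d ⟨n, P, Q, ε, ϖ₀, r, hε, hT, hA, hV, halg, hϖ₀, hdom, heq, rfl⟩
  exact hK n P Q ε hε hT hA hV ϖ₀ halg hϖ₀ r hdom heq

/-- **`Assembly`** (settles stmt-KontsevichZagierPeriods-9137, route InverseLandau):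
`TateFamilyKernel → TateLifting → KontsevichZagierPeriods`. Proof: the two hypotheses give the
kernel form `KZKernelConjecture` (`kzKernelConjecture_of_kernel_of_lifting`), and the kernel form
implies the KZ-literal period conjecture
(`Summit.KontsevichZagierPeriods.KernelForm.kontsevichZagierPeriods_of_kzKernelConjecture`:
`r.value = r'.value ⇒ eval ([r] − [r']) = 0 ⇒ [r] − [r'] ∈ KZ.relations`).
[Kontsevich–Zagier 2001, §1.2; Huber–Müller-Stach 2017, §13.1] [folklore] -/
theorem assembly_proof :
    Summit.KontsevichZagierPeriods.KontsevichZagierPeriods.Theses.InverseLandau.Assembly := by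
  unfold Summit.KontsevichZagierPeriods.KontsevichZagierPeriods.Theses.InverseLandau.Assembly
  intro hK hL
  exact Summit.KontsevichZagierPeriods.KernelForm.kontsevichZagierPeriods_of_kzKernelConjecture
    (kzKernelConjecture_of_kernel_of_lifting hK hL)

end Summit.KontsevichZagierPeriods.InverseLandau.Assembly
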